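/-
Copyright: the b2b-balaban T⁴-continuum CRUX team, row NE7b OWNER lineage `t4-ne7b-p1` (gen 117). Project licence.
-/
import Mathlib.Analysis.Convex.Strong
import Summits.QuantumFields.BalabanUV.T4Continuum.Spine.NE7b.SupTorusEffectiveActionConvex
import Summits.QuantumFields.BalabanUV.T4Continuum.Spine.NE7b.FluctuationStepMarginal

/-!
# THE TORUS ACTION IN THE HILBERT CURRENCY: `StrongConvexOn K₂ (min(2,a) − λ) S` ON THE EUCLIDEAN TORUS CARRIER — the junction
# from the sup road's action `S φ = ½Σ φ·(Rf(A(Ef φ))) + Σ v(φ x)` (`v′ = u`, `u′ ≥ −λ`) to the `…FluctuationStep*` road's `hV`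
# letter, in Mathlib's `StrongConvexOn` on `EuclideanSpace ℝ (Site d ((n+1)s))`, on every convex window `K₂`, transported along
# any linear isometry to `EuclideanSpace ℝ (Fin k)`; and THE END through (31): the fluctuation-step marginal
# `ψ ↦ −log ∫_{K₂} e^{−(S φ + G(ψ − Qφ))} dφ` of the torus action is strongly convex with modulus `a′σ∕(σ + a′κ²)`,
# `σ = min(2,a) − λ` (row NE7b, node U5c; (94) `action_secant_upper` + (31) `strongConvexOn_neg_log_stepMarginal_of_isBounded`
# BY NAME; [folklore])

Cell `pub-balaban`, sub-cell `t4`, spine estimate NE7b (`T4WeightBudget.RelWeightBound`; the cell's OWN estimate — NOT PRINTED in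
[Bałaban 1983–89], NOT PROVED).  Crux-route work under `Spine/NE7b/` by the row OWNER (`t4-ne7b-p1` gen 117) under FREEZE (0)'s
crux-prover clause, on the OWNER g116's located NEXT item (3)(i) «the `FluctuationStep*` junction (Hilbert currency)»; NOTHING of
Bałaban's is named as a Lean object, valued or asserted; no `T4Continuum/Support` leaf typed; no `def`, no notation; zero `sorry`.
Imports (BY NAME): `Mathlib.Analysis.Convex.Strong` (`StrongConvexOn`, `UniformConvexOn`), the OWNER's (94)
`…SupTorusEffectiveActionConvex` (`action_secant_upper`; through it (89) `torus_form_coercive`, TDF `torus_operator_form_symm`, TEA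
`differentiableAt_action`, (93) `hasDerivAt_phiFour_potential`, (86) `hasDerivAt_phiFour`), the OWNER's (31)
`…FluctuationStepMarginal` (`strongConvexOn_neg_log_stepMarginal_of_isBounded`).

WHY (located).  The `…FluctuationStep*` road ((26)–(34)) is written in the Hilbert currency: carriers `EuclideanSpace ℝ (Fin n)`,
potentials `V` with `StrongConvexOn K₂ σ V`, and it returns the next action `−log ∫_{K₂} e^{−(V + G(ψ − Q·))}` strongly convex with
modulus `aσ∕(σ + aκ²)`.  The sup road's action lives on `Site d N → ℝ` with the sup norm, where `StrongConvexOn` with Mathlib's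
norm would be the wrong statement.  (94)'s secant letter is already the Euclidean one — its gain is `½(γ − λ)θ(1−θ)·Σ_x (φ − ψ)²`, and
`Σ_x (φ x − ψ x)² = ‖φ − ψ‖²` on `EuclideanSpace ℝ ι` — so the junction is bookkeeping: read the action through `WithLp.ofLp`, and
move between index types along linear isometries (which preserve `StrongConvexOn`).  Then (31) applies to the torus action verbatim.

WHAT IS PROVED ([folklore]):
* §1 (Mathlib's `StrongConvexOn`, any real normed space) `strongConvexOn_of_subset` (restriction to a convex subset),
  **`strongConvexOn_comp_linearIsometry`** (`StrongConvexOn univ m f ⟹ StrongConvexOn univ m (f ∘ L)` for a linear isometry `L`),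
  and on `EuclideanSpace ℝ ι`: **`strongConvexOn_of_secant`** (a secant letter with gain `½m·θ(1−θ)·Σ_i (x i − y i)²` on a convex `s`
  IS `StrongConvexOn s m`).
* §2 (TEA's level) **`strongConvexOn_action_euclid`**: symmetric `At` with a form floor `γ`, `v′ = u`, `u′ ≥ −λ` ⟹ for every convex
  `s ⊆ EuclideanSpace ℝ ι`, `StrongConvexOn s (γ − λ) (φ ↦ ½Σ φ·At φ + Σ v(φ x))` (the action read through `WithLp.ofLp`);
  `continuous_action_euclid`.
* §3 (the `Beta.Site` carriers, displayed actions) **`torus_strongConvexOn_action`** (`u′ ≥ −λ` ⟹ `StrongConvexOn K₂ (min(2,a) − λ) S`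
  on every convex `K₂ ⊆ EuclideanSpace ℝ (Site d ((n+1)s))`, every `n, a, s, d`), **`torus_strongConvexOn_action_reindexed`** (the same
  on `EuclideanSpace ℝ (Fin k)` along any linear isometry `L`), **`phiFour_strongConvexOn_action`** (`g ≥ 0`: modulus `min(2,a) + m`),
  **`torus_strongConvexOn_effectiveAction`** (`λ < min(2,a)`, ANY background map `Φ`: the EFFECTIVE ACTION `w ↦ S(Φ w)` is
  `StrongConvexOn univ ((min(2,a) − λ)(n+1)^d)` on `EuclideanSpace ℝ (Site d s)` — the next step's `hV` letter, from (94)'s secant letter).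
* §4 THE END **`torus_stepMarginal_strongConvexOn`**: (31)'s `strongConvexOn_neg_log_stepMarginal_of_isBounded` with `V :=` the torus
  action read on `EuclideanSpace ℝ (Fin k)` through a linear isometry `L` onto the Euclidean torus carrier — for every convex,
  measurable, bounded window `K₂` of positive volume, every continuous `a′`-strongly convex `G`, every linear `Q` with `‖Q y‖ ≤ κ‖y‖`,
  `0 ≤ σ := min(2,a) − λ`, `0 < σ + a′κ²`, every convex `B`:
  `StrongConvexOn B (a′σ∕(σ + a′κ²)) (ψ ↦ −log ∫_{K₂} exp(−(S(L φ) + G(ψ − Q φ))) dφ)`.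
* §5 toy.

HONEST (what this is NOT).  Bookkeeping between currencies + (94) + (31) by name; which `G, Q, κ, K₂` the road's steps display, and
whether the road's `V` should carry the `aQ′*Q′` term of `A` or not (with `a = 0` the floor is `min(2,0) = 0` and the modulus is
`−λ`, i.e. a uniformly convex potential is needed) is the road's call, not made here; the reindexing `L` is ANY linear isometry (no
canonical `Fin k`-numbering of the torus is chosen); one-sided curvature only; nothing about Bałaban's steps ((A3) ∕ (A1c), NC-NE7b-α
UNRULED).  BY-NAME EFFECT ON THE WALL: NONE.  NE7b NOT PRINTED ∕ NOT PROVED; spine PROVED 0∕9; rung (B)+1 on a FINITE torus — NOT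
infinite volume, NOT the mass gap, NOT Clay.  HONEST DEPENDENCY: continuum YM on T⁴ ⇐ BetaPertH ∧ nine spine estimates (0∕9 proved);
BetaPertH ⇐ (D1) ∧ (D4) ∧ CAP+tail; G-an2-4 gates asym, D1 and NE2∕3∕4.
-/

set_option autoImplicit false

noncomputable section

namespace Summit.QuantumFields.BalabanUV.T4Continuum.NE7b.SupTorusActionConvexEuclid

open Set Function MeasureTheory Real Bornology
open scoped ENNReal Topology
open Literature.MathematicalPhysics.QuantumFieldTheory.Balaban1983to89
open B6QGQLower276 (X blk B side AX)
open B5Hk103ScalarZd (nbhd)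
open Beta (Site siteOf windowMap)
open SupTorusDirichletForm (torus_operator_form_symm)
open SupTorusDirichletFormCoercive (torus_form_coercive)
open SupTorusEffectiveAction (differentiableAt_action)
open SupTorusEffectiveActionConvex (action_secant_upper)
open SupTorusActionMinimiser (hasDerivAt_phiFour_potential)
open SupPhiFourBackground (hasDerivAt_phiFour)
open FluctuationStepMarginal (strongConvexOn_neg_log_stepMarginal_of_isBounded)

variable {d : ℕ}

/-! ## §1. `StrongConvexOn`: restriction, transport along linear isometries, and the Euclidean secant letter -/

section Strong

variable {E E' : Type*} [NormedAddCommGroup E] [NormedSpace ℝ E] [NormedAddCommGroup E'] [NormedSpace ℝ E']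

/-- `StrongConvexOn` restricts to convex subsets. [folklore] -/
theorem strongConvexOn_of_subset {s t : Set E} {m : ℝ} {f : E → ℝ} (hf : StrongConvexOn t m f) (hst : s ⊆ t)
    (hs : Convex ℝ s) : StrongConvexOn s m f :=
  ⟨hs, fun _ hx _ hy _ _ ha hb hab => hf.2 (hst hx) (hst hy) ha hb hab⟩

/-- **`StrongConvexOn univ` IS PRESERVED BY PRECOMPOSITION WITH A LINEAR ISOMETRY** (`‖L x − L y‖ = ‖x − y‖`). [folklore] -/
theorem strongConvexOn_comp_linearIsometry {m : ℝ} {f : E → ℝ} (hf : StrongConvexOn univ m f) (L : E' →ₗᵢ[ℝ] E) :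
    StrongConvexOn univ m (fun x => f (L x)) := by
  refine ⟨convex_univ, fun x _ y _ a b ha hb hab => ?_⟩
  have h := hf.2 (mem_univ (L x)) (mem_univ (L y)) ha hb hab
  have hL : L (a • x + b • y) = a • L x + b • L y := by rw [L.map_add, L.map_smul, L.map_smul]
  have hn : ‖L x - L y‖ = ‖x - y‖ := by rw [← L.map_sub, L.norm_map]
  show f (L (a • x + b • y)) ≤ a • f (L x) + b • f (L y) - a * b * ((m / 2) * ‖x - y‖ ^ 2)
  rw [hL, ← hn]
  exact h

variable {ι : Type*} [Fintype ι]

/-- **A EUCLIDEAN SECANT LETTER IS `StrongConvexOn`**: on a convex `s ⊆ EuclideanSpace ℝ ι`, if for all `θ ∈ [0,1]` and `x y ∈ s`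
`f(θx + (1−θ)y) + ½m·θ(1−θ)·Σ_i (x i − y i)² ≤ θ·f x + (1−θ)·f y`, then `StrongConvexOn s m f` (`Σ_i (x i − y i)² = ‖x − y‖²`).
[folklore] -/
theorem strongConvexOn_of_secant {s : Set (EuclideanSpace ℝ ι)} (hs : Convex ℝ s) {f : EuclideanSpace ℝ ι → ℝ} {m : ℝ}
    (h : ∀ θ : ℝ, 0 ≤ θ → θ ≤ 1 → ∀ x ∈ s, ∀ y ∈ s,
      f (θ • x + (1 - θ) • y) + m / 2 * θ * (1 - θ) * ∑ i, (x i - y i) ^ 2 ≤ θ * f x + (1 - θ) * f y) :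
    StrongConvexOn s m f := by
  refine ⟨hs, fun x hx y hy a b ha hb hab => ?_⟩
  have hb' : b = 1 - a := by linarith
  subst hb'
  have h1 := h a ha (by linarith) x hx y hy
  have hn : ‖x - y‖ ^ 2 = ∑ i, (x i - y i) ^ 2 := by
    rw [EuclideanSpace.real_norm_sq_eq]
    simp only [PiLp.sub_apply]
  dsimp only
  rw [smul_eq_mul, smul_eq_mul, hn]
  linarith

end Strong

/-! ## §2. TEA's level: the action on `EuclideanSpace ℝ ι` is strongly convex -/

section Generic

variable {ι : Type*} [Fintype ι]

/-- **THE ACTION IS `StrongConvexOn` IN THE EUCLIDEAN CURRENCY**: symmetric `At` with a form floor `γ`, `v′ = u`, `u′ ≥ −λ` ⟹ on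
every convex `s ⊆ EuclideanSpace ℝ ι`, `StrongConvexOn s (γ − λ) (φ ↦ ½Σ_x φ x·(At φ) x + Σ_x v(φ x))`, the action read through
`WithLp.ofLp` ((94) `action_secant_upper`). [folklore] -/
theorem strongConvexOn_action_euclid (At : (ι → ℝ) →L[ℝ] (ι → ℝ))
    (hAt : ∀ φ ψ : ι → ℝ, ∑ x, ψ x * At φ x = ∑ x, φ x * At ψ x) {γ : ℝ}
    (hγ : ∀ h : ι → ℝ, γ * ∑ x, h x ^ 2 ≤ ∑ x, h x * At h x) {v u u' : ℝ → ℝ} (hv : ∀ t, HasDerivAt v (u t) t)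
    (hu : ∀ t, HasDerivAt u (u' t) t) {lam : ℝ} (hu' : ∀ t, -lam ≤ u' t) {s : Set (EuclideanSpace ℝ ι)}
    (hs : Convex ℝ s) :
    StrongConvexOn s (γ - lam) (fun φ : EuclideanSpace ℝ ι =>
      (1 / 2 : ℝ) * ∑ x, (WithLp.ofLp φ) x * At (WithLp.ofLp φ) x + ∑ x, v ((WithLp.ofLp φ) x)) := by
  refine strongConvexOn_of_secant hs fun θ hθ0 hθ1 x _ y _ => ?_
  have h := action_secant_upper At hAt hγ hv hu hu' hθ0 hθ1 (WithLp.ofLp x) (WithLp.ofLp y)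
  rw [WithLp.ofLp_add, WithLp.ofLp_smul, WithLp.ofLp_smul]
  exact h

/-- The action read through `WithLp.ofLp` is continuous on `EuclideanSpace ℝ ι`. [folklore] -/
theorem continuous_action_euclid (At : (ι → ℝ) →L[ℝ] (ι → ℝ))
    (hAt : ∀ φ ψ : ι → ℝ, ∑ x, ψ x * At φ x = ∑ x, φ x * At ψ x) {v u : ℝ → ℝ} (hv : ∀ t, HasDerivAt v (u t) t) :
    Continuous (fun φ : EuclideanSpace ℝ ι =>
      (1 / 2 : ℝ) * ∑ x, (WithLp.ofLp φ) x * At (WithLp.ofLp φ) x + ∑ x, v ((WithLp.ofLp φ) x)) := by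
  have hS : Continuous (fun φ : ι → ℝ => (1 / 2 : ℝ) * ∑ x, φ x * At φ x + ∑ x, v (φ x)) :=
    (show Differentiable ℝ (fun φ : ι → ℝ => (1 / 2 : ℝ) * ∑ x, φ x * At φ x + ∑ x, v (φ x)) from
      fun φ => differentiableAt_action At hAt hv φ).continuous
  exact hS.comp (PiLp.continuous_ofLp 2 (fun _ : ι => ℝ))

end Generic

/-! ## §3. The torus: `StrongConvexOn K₂ (min(2,a) − λ) S` on the Euclidean torus carrier -/

section Torus

variable (n : ℕ) (a : ℝ) (s : ℕ) [NeZero s]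
  {Aop : lp (fun _ : X d => ℝ) ∞ →L[ℝ] lp (fun _ : X d => ℝ) ∞}
  (hA : ∀ (f : lp (fun _ : X d => ℝ) ∞) (p : X d), Aop f p = ∑ r ∈ nbhd n p, AX n a p r * f r)
  {v u u' : ℝ → ℝ} (hv : ∀ t, HasDerivAt v (u t) t) (hu : ∀ t, HasDerivAt u (u' t) t)
  {lam : ℝ} (hu' : ∀ t, -lam ≤ u' t)
  {Ef : (Site d ((n + 1) * s) → ℝ) →L[ℝ] lp (fun _ : X d => ℝ) ∞}
  (hEf : ∀ (g : Site d ((n + 1) * s) → ℝ) (q : X d), Ef g q = g (siteOf d ((n + 1) * s) q))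
  {Rf : lp (fun _ : X d => ℝ) ∞ →L[ℝ] (Site d ((n + 1) * s) → ℝ)}
  (hRf : ∀ (h : lp (fun _ : X d => ℝ) ∞) (x : Site d ((n + 1) * s)), Rf h x = h (windowMap d ((n + 1) * s) x))

include hA hv hu hu' hEf hRf in
/-- **THE TORUS ACTION IS `StrongConvexOn K₂ (min(2,a) − λ)`** on every convex `K₂ ⊆ EuclideanSpace ℝ (Site d ((n+1)s))`: `At = Rf∘Aop∘Ef`
(floor `min(2,a)` by (89)), `v′ = u`, `u′ ≥ −λ` — every side `n + 1`, every `a`, every period `s ≥ 1`, every `d`; the `…FluctuationStep*`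
road's `hV` letter for the sup road's action. [folklore] -/
theorem torus_strongConvexOn_action {K₂ : Set (EuclideanSpace ℝ (Site d ((n + 1) * s)))} (hK₂ : Convex ℝ K₂) :
    StrongConvexOn K₂ (min 2 a - lam) (fun φ : EuclideanSpace ℝ (Site d ((n + 1) * s)) =>
      (1 / 2 : ℝ) * ∑ x, (WithLp.ofLp φ) x * ((Rf.comp Aop).comp Ef) (WithLp.ofLp φ) x + ∑ x, v ((WithLp.ofLp φ) x)) :=
  strongConvexOn_action_euclid ((Rf.comp Aop).comp Ef) (torus_operator_form_symm n a s hA hEf hRf)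
    (torus_form_coercive n a s hA hEf hRf) hv hu hu' hK₂

include hA hv hu hu' hEf hRf in
/-- **THE SAME ON `EuclideanSpace ℝ (Fin k)` ALONG ANY LINEAR ISOMETRY** `L` onto the Euclidean torus carrier (e.g. a renumbering
`LinearIsometryEquiv.piLpCongrLeft`), on every convex window `K₂`. [folklore] -/
theorem torus_strongConvexOn_action_reindexed {k : ℕ}
    (L : EuclideanSpace ℝ (Fin k) →ₗᵢ[ℝ] EuclideanSpace ℝ (Site d ((n + 1) * s)))
    {K₂ : Set (EuclideanSpace ℝ (Fin k))} (hK₂ : Convex ℝ K₂) :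
    StrongConvexOn K₂ (min 2 a - lam) (fun φ : EuclideanSpace ℝ (Fin k) =>
      (1 / 2 : ℝ) * ∑ x, (WithLp.ofLp (L φ)) x * ((Rf.comp Aop).comp Ef) (WithLp.ofLp (L φ)) x
        + ∑ x, v ((WithLp.ofLp (L φ)) x)) :=
  strongConvexOn_of_subset
    (strongConvexOn_comp_linearIsometry (torus_strongConvexOn_action n a s hA hv hu hu' hEf hRf convex_univ) L)
    (subset_univ _) hK₂

/-- **THE `φ⁴_d` TORUS ACTION IS `StrongConvexOn K₂ (min(2,a) + m)`** (`g ≥ 0`; every convex `K₂`; ANY operators ∕ carrier maps with the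
displayed actions): the quartic only helps. [folklore] -/
theorem phiFour_strongConvexOn_action (n : ℕ) (a : ℝ) (s : ℕ) [NeZero s]
    {Aop : lp (fun _ : X d => ℝ) ∞ →L[ℝ] lp (fun _ : X d => ℝ) ∞}
    (hA : ∀ (f : lp (fun _ : X d => ℝ) ∞) (p : X d), Aop f p = ∑ r ∈ nbhd n p, AX n a p r * f r)
    {Ef : (Site d ((n + 1) * s) → ℝ) →L[ℝ] lp (fun _ : X d => ℝ) ∞}
    (hEf : ∀ (g : Site d ((n + 1) * s) → ℝ) (q : X d), Ef g q = g (siteOf d ((n + 1) * s) q))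
    {Rf : lp (fun _ : X d => ℝ) ∞ →L[ℝ] (Site d ((n + 1) * s) → ℝ)}
    (hRf : ∀ (h : lp (fun _ : X d => ℝ) ∞) (x : Site d ((n + 1) * s)), Rf h x = h (windowMap d ((n + 1) * s) x))
    {g m : ℝ} (hg : 0 ≤ g) {K₂ : Set (EuclideanSpace ℝ (Site d ((n + 1) * s)))} (hK₂ : Convex ℝ K₂) :
    StrongConvexOn K₂ (min 2 a + m) (fun φ : EuclideanSpace ℝ (Site d ((n + 1) * s)) =>
      (1 / 2 : ℝ) * ∑ x, (WithLp.ofLp φ) x * ((Rf.comp Aop).comp Ef) (WithLp.ofLp φ) x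
        + ∑ x, (g / 4 * ((WithLp.ofLp φ) x) ^ 4 + m / 2 * ((WithLp.ofLp φ) x) ^ 2)) := by
  have h := torus_strongConvexOn_action n a s hA (v := fun t => g / 4 * t ^ 4 + m / 2 * t ^ 2)
    (u := fun t => g * t ^ 3 + m * t) (u' := fun t => 3 * g * t ^ 2 + m) (hasDerivAt_phiFour_potential g m)
    (hasDerivAt_phiFour g m) (lam := -m) (fun t => by nlinarith [sq_nonneg t]) hEf hRf hK₂
  simpa only [sub_neg_eq_add] using h

include hA hv hu hu' hEf hRf in
/-- **THE EFFECTIVE ACTION IS `StrongConvexOn univ ((min(2,a) − λ)(n+1)^d)` ON THE EUCLIDEAN COARSE CARRIER** (`λ < min(2,a)`): for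
ANY background map `Φ` (block means `Q′t (Φ w) = w` and the sitewise equation at every `w`; it exists uniquely by (93)), the function
`w ↦ S (Φ w)` read on `EuclideanSpace ℝ (Site d s)` is strongly convex with modulus `(min(2,a) − λ)(n+1)^d` ((94)'s secant letter between
backgrounds) — the NEXT step's `hV` letter, on the whole coarse carrier. [folklore] -/
theorem torus_strongConvexOn_effectiveAction (hγ : lam < min 2 a)
    {Dop : lp (fun _ : X d => ℝ) ∞ →L[ℝ] lp (fun _ : X d => ℝ) ∞}
    (hD : ∀ (f : lp (fun _ : X d => ℝ) ∞) (y : X d), Dop f y = (((n : ℝ) + 1) ^ d)⁻¹ * ∑ p ∈ B n y, f p)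
    {Rc : lp (fun _ : X d => ℝ) ∞ →L[ℝ] (Site d s → ℝ)}
    (hRc : ∀ (h : lp (fun _ : X d => ℝ) ∞) (x : Site d s), Rc h x = h (windowMap d s x))
    (Φ : (Site d s → ℝ) → (Site d ((n + 1) * s) → ℝ)) (hΦQ : ∀ w : Site d s → ℝ, ((Rc.comp Dop).comp Ef) (Φ w) = w)
    (hΦeq : ∀ (w : Site d s → ℝ) (p : X d), Aop (Ef (Φ w)) p + u (Ef (Φ w) p)
      = (((n : ℝ) + 1) ^ d)⁻¹ * ∑ p' ∈ B n (blk n p), (Aop (Ef (Φ w)) p' + u (Ef (Φ w) p'))) :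
    StrongConvexOn univ ((min 2 a - lam) * ((n : ℝ) + 1) ^ d) (fun w : EuclideanSpace ℝ (Site d s) =>
      (1 / 2 : ℝ) * ∑ x, Φ (WithLp.ofLp w) x * ((Rf.comp Aop).comp Ef) (Φ (WithLp.ofLp w)) x + ∑ x, v (Φ (WithLp.ofLp w) x)) := by
  refine strongConvexOn_of_secant convex_univ fun θ hθ0 hθ1 w _ w' _ => ?_
  have h := SupTorusEffectiveActionConvex.torus_effectiveAction_secant n a s hD hA hv hu hu' hγ hEf hRf hRc hθ0 hθ1
    (wt := WithLp.ofLp w) (wt' := WithLp.ofLp w') (φθ := Φ (WithLp.ofLp (θ • w + (1 - θ) • w')))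
    (by rw [hΦQ, WithLp.ofLp_add, WithLp.ofLp_smul, WithLp.ofLp_smul]) (hΦeq _) (hΦQ _) (hΦQ _)
  have hre : (min 2 a - lam) * ((n : ℝ) + 1) ^ d / 2 * θ * (1 - θ) * ∑ i, (w i - w' i) ^ 2
      = (min 2 a - lam) / 2 * θ * (1 - θ) * (((n : ℝ) + 1) ^ d * ∑ y, (WithLp.ofLp w y - WithLp.ofLp w' y) ^ 2) := by
    ring
  rw [hre]
  exact h

end Torus

/-! ## §4. THE END: the fluctuation-step marginal of the torus action is strongly convex ((31) fed) -/

/-- **THE FLUCTUATION-STEP MARGINAL OF THE TORUS ACTION IS STRONGLY CONVEX** ((31) `strongConvexOn_neg_log_stepMarginal_of_isBounded` with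
`V :=` the torus action read on `EuclideanSpace ℝ (Fin k)` through a linear isometry `L` onto the Euclidean torus carrier):
`u′ ≥ −λ`, `σ := min(2,a) − λ ≥ 0`; `K₂ ⊆ ℝᵏ` convex, measurable, bounded, of positive volume; `G` continuous and `a′`-strongly convex;
`Q` linear with `‖Q y‖ ≤ κ‖y‖`; `0 < σ + a′κ²`; `B` convex ⟹
`StrongConvexOn B (a′σ∕(σ + a′κ²)) (ψ ↦ −log ∫_{K₂} exp(−(S(L φ) + G(ψ − Q φ))) dφ)` — every mesh, period, dimension. [folklore] -/
theorem torus_stepMarginal_strongConvexOn (n : ℕ) (a : ℝ) (s : ℕ) [NeZero s]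
    {Aop : lp (fun _ : X d => ℝ) ∞ →L[ℝ] lp (fun _ : X d => ℝ) ∞}
    (hA : ∀ (f : lp (fun _ : X d => ℝ) ∞) (p : X d), Aop f p = ∑ r ∈ nbhd n p, AX n a p r * f r)
    {v u u' : ℝ → ℝ} (hv : ∀ t, HasDerivAt v (u t) t) (hu : ∀ t, HasDerivAt u (u' t) t)
    {lam : ℝ} (hu' : ∀ t, -lam ≤ u' t) (hσ : 0 ≤ min 2 a - lam)
    {Ef : (Site d ((n + 1) * s) → ℝ) →L[ℝ] lp (fun _ : X d => ℝ) ∞}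
    (hEf : ∀ (g : Site d ((n + 1) * s) → ℝ) (q : X d), Ef g q = g (siteOf d ((n + 1) * s) q))
    {Rf : lp (fun _ : X d => ℝ) ∞ →L[ℝ] (Site d ((n + 1) * s) → ℝ)}
    (hRf : ∀ (h : lp (fun _ : X d => ℝ) ∞) (x : Site d ((n + 1) * s)), Rf h x = h (windowMap d ((n + 1) * s) x))
    {k m : ℕ} (L : EuclideanSpace ℝ (Fin k) →ₗᵢ[ℝ] EuclideanSpace ℝ (Site d ((n + 1) * s)))
    {K₂ : Set (EuclideanSpace ℝ (Fin k))} (hK₂m : MeasurableSet K₂) (hK₂c : Convex ℝ K₂) (hK₂b : IsBounded K₂)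
    (hK₂v : 0 < volume K₂) {G : EuclideanSpace ℝ (Fin m) → ℝ} (hGc : Continuous G) {a' κ : ℝ} (hG : StrongConvexOn univ a' G)
    (hD : 0 < (min 2 a - lam) + a' * κ ^ 2) (Q : EuclideanSpace ℝ (Fin k) →ₗ[ℝ] EuclideanSpace ℝ (Fin m))
    (hQ : ∀ y, ‖Q y‖ ≤ κ * ‖y‖) {Bset : Set (EuclideanSpace ℝ (Fin m))} (hB : Convex ℝ Bset) :
    StrongConvexOn Bset (a' * (min 2 a - lam) / ((min 2 a - lam) + a' * κ ^ 2)) fun ψ =>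
      -log (∫ φ in K₂, exp (-(((1 / 2 : ℝ) * ∑ x, (WithLp.ofLp (L φ)) x * ((Rf.comp Aop).comp Ef) (WithLp.ofLp (L φ)) x
        + ∑ x, v ((WithLp.ofLp (L φ)) x)) + G (ψ - Q φ)))) :=
  strongConvexOn_neg_log_stepMarginal_of_isBounded hK₂m hK₂c hK₂b hK₂v
    ((continuous_action_euclid ((Rf.comp Aop).comp Ef) (torus_operator_form_symm n a s hA hEf hRf) hv).comp L.continuous) hGc
    (torus_strongConvexOn_action_reindexed n a s hA hv hu hu' hEf hRf L hK₂c) hG hσ hD Q hQ hB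

/-! ## §5. Toy -/

/-- Toy (§1): the zero function on `EuclideanSpace ℝ Unit` is `0`-strongly convex (secant letter with zero gain). -/
example : StrongConvexOn (univ : Set (EuclideanSpace ℝ Unit)) 0 (fun _ => (0 : ℝ)) :=
  strongConvexOn_of_secant convex_univ fun θ _ _ x _ y _ => by simp

end Summit.QuantumFields.BalabanUV.T4Continuum.NE7b.SupTorusActionConvexEuclid

end
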